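import Summits.HodgeConjecture.HodgeConjecture.Theorems.HodgeFermatVarieties.Negative.LevelThirtyThreeInsufficient

/-!
# `HodgeFermatVarieties` (stmt-HodgeConjecture-1334): da Silva's class is NOT ℤ-reachable from the printed supply at its own level `33`

Negative lemma of the standing disprover (cdisprove cycle 3), sorry-free, axioms
`{propext, Classical.choice, Quot.sound}`.

The picked line `cancel-by-any-claim-lattice` (Cruxes/HodgeFermatVarieties/Lines/cancel-by-any-claim-lattice.lean)
proves `stableReach_daSilvaGap : StableReach[33, (7,10,13,19,22,28)]` with the level-raising parameter `k = 2`
(the level-`66` certificate). Here, in the SAME vocabulary (the line's four `local notation3` lines, copied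
verbatim), `k = 1` is refuted: `¬ Reach[33, (7,10,13,19,22,28)]` and `¬ Reach[33, (1,4,16,25,31,22)]` — the
printed supply of level `33` (pairs, Hodge 4-multisets, Hodge semi-decomposable sextuples, Aoki standard
elements `σ_{3,a}`, `σ_{11,a}` under the side condition `d/(⟨a⟩,d) > 2`) spans, as a ℤ-lattice of
multiplicity vectors, only multisets with an EVEN number of multiples of `11`, by the landed parity lemmas
(`even_countP_of_card_four`, `even_countP_of_isSemiDecomposable`, `even_countP_standard3/11`), while
da Silva's class has one such entry. So level change is NECESSARY in that line, not a convenience.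
[cite: daSilva2021HodgeFermat, Prop. 3.4 (version of record) = arXiv:2101.04739 Prop. 3.6]
[cite: Aoki1987, Thm. 1-1, Thm. 2-1]
-/

set_option linter.dupNamespace false

namespace Summit.HodgeConjecture.HodgeConjecture.Theorems.HodgeFermatVarietiesNegative

open Finset Multiset
open Literature.AlgebraicGeometry.HodgeTheory Literature.AlgebraicGeometry.HodgeTheory.FermatCharacter

/-! ### The line's vocabulary (local notations, verbatim from `Lines/cancel-by-any-claim-lattice.lean`) -/

local notation3 (prettyPrint := false) "Supply[" M "]" =>
  ({s : Multiset (ZMod M) | ∃ a : ZMod M, a ≠ 0 ∧ s = ({a, -a} : Multiset (ZMod M))} ∪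
    {s : Multiset (ZMod M) | IsHodgeMultiset s ∧ Multiset.card s = 4} ∪
    {s : Multiset (ZMod M) | IsHodgeMultiset s ∧ IsSemiDecomposable s} ∪
    {s : Multiset (ZMod M) | ∃ (p : ℕ) (a : ZMod M), p.Prime ∧ p ≠ 2 ∧ p ∣ M ∧
        2 < (M / p) / Nat.gcd (ZMod.val a) (M / p) ∧
        s = Multiset.map (fun j : ℕ => a + (j : ZMod M) * ((M / p : ℕ) : ZMod M)) (Multiset.range p) +
              {-((p : ZMod M) * a)}} : Set (Multiset (ZMod M)))

local notation3 (prettyPrint := false) "Reach[" M ", " s "]" =>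
  ∃ P N : Multiset (Multiset (ZMod M)),
    (∀ u ∈ P, u ∈ Supply[M]) ∧ (∀ u ∈ N, u ∈ Supply[M]) ∧ s + Multiset.sum N = Multiset.sum P

/-- The level-`33` parity functional: number of entries divisible by `11`. [folklore] -/
abbrev par33 (s : Multiset (ZMod 33)) : ℕ := s.countP (· ∈ ({11, 22} : Finset (ZMod 33)))

/-- Aoki's side condition `d/(⟨a⟩, d) > 2` at level `33` forces `(⟨a⟩, d) = 1` (`d ∈ {11, 3}` is prime).
[cite: Aoki1987, Thm. 2-1] -/
theorem coprime_of_side33 {p : ℕ} (hp : p = 3 ∨ p = 11) {a : ZMod 33}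
    (h : 2 < (33 / p) / Nat.gcd (ZMod.val a) (33 / p)) : Nat.Coprime a.val (33 / p) := by
  rcases hp with rfl | rfl
  · have hd : Nat.gcd a.val (33 / 3) ∣ 11 := Nat.gcd_dvd_right _ _
    rcases (Nat.dvd_prime (by norm_num)).1 hd with h1 | h11
    · exact h1
    · rw [show (33 / 3 : ℕ) = 11 from rfl, h11] at h; norm_num at h
  · have hd : Nat.gcd a.val (33 / 11) ∣ 3 := Nat.gcd_dvd_right _ _
    rcases (Nat.dvd_prime Nat.prime_three).1 hd with h1 | h3
    · exact h1
    · rw [show (33 / 11 : ℕ) = 3 from rfl, h3] at h; norm_num at h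

/-- **Every element of the printed supply of level `33` has an even number of multiples of `11`.**
[cite: Aoki1987, Thm. 1-1, Thm. 2-1] [cite: daSilva2021HodgeFermat, §2] -/
theorem even_par33_of_mem_supply : ∀ u ∈ Supply[33], Even (par33 u) := by
  rintro u (((⟨a, ha, rfl⟩ | ⟨hu, h4⟩) | ⟨hu, hsemi⟩) | ⟨p, a, hp, _, hpd, hside, rfl⟩)
  · exact isShiodaClosed_parity33.pair a ha
  · exact even_countP_of_card_four hu h4
  · exact even_countP_of_isSemiDecomposable hu hsemi
  · have hlt : 2 < 33 / p := lt_of_lt_of_le hside (Nat.div_le_self _ _)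
    have hp' := prime_dvd_33 hp hpd hlt
    have hcop := coprime_of_side33 hp' hside
    rcases hp' with rfl | rfl
    · exact even_countP_standard3 a hcop
    · exact even_countP_standard11 a hcop

/-- Sums of supply elements have even parity. [folklore] -/
theorem even_par33_sum {P : Multiset (Multiset (ZMod 33))} (h : ∀ u ∈ P, u ∈ Supply[33]) :
    Even (par33 P.sum) := by
  induction P using Multiset.induction_on with
  | empty => simp
  | cons u P ih =>
    rw [Multiset.sum_cons]
    show Even (Multiset.countP _ (u + P.sum))
    rw [countP_add]
    exact (even_par33_of_mem_supply u (h u (mem_cons_self _ _))).add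
      (ih fun v hv ↦ h v (mem_cons_of_mem hv))

/-- **A multiset with an odd number of multiples of `11` is not ℤ-reachable at level `33`.** [folklore] -/
theorem not_reach33_of_odd {s : Multiset (ZMod 33)} (hs : ¬ Even (par33 s)) : ¬ Reach[33, s] := by
  rintro ⟨P, N, hP, hN, hEq⟩
  have h1 : Even (par33 (s + N.sum)) := by rw [hEq]; exact even_par33_sum hP
  have h2 : par33 (s + N.sum) = par33 s + par33 N.sum := countP_add _ _ _
  rw [h2] at h1
  exact hs ((Nat.even_add.1 h1).2 (even_par33_sum hN))

/-- **da Silva's class `(1,4,16,25,31,22)` of `X⁴₃₃` is not ℤ-reachable from the printed supply at level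
`33`** (`k = 1` of `StableReach` fails; the line's `k = 2` is necessary).
[cite: daSilva2021HodgeFermat, Prop. 3.4 (version of record) = arXiv:2101.04739 Prop. 3.6] -/
theorem not_reach33_daSilva : ¬ Reach[33, ({1, 4, 16, 25, 31, 22} : Multiset (ZMod 33))] :=
  not_reach33_of_odd not_even_countP_daSilva33

/-- The same for the unit-orbit representative `(7,10,13,19,22,28)` used by the line's certificate
`stableReach_daSilvaGap`. [cite: daSilva2021HodgeFermat, Prop. 3.4 (version of record)] -/
theorem not_reach33_daSilvaGap : ¬ Reach[33, ({7, 10, 13, 19, 22, 28} : Multiset (ZMod 33))] :=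
  not_reach33_of_odd (by decide)

end Summit.HodgeConjecture.HodgeConjecture.Theorems.HodgeFermatVarietiesNegative
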